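import Literature.MathematicalPhysics.QuantumFieldTheory.Balaban1983to89.B9SectBStepFrameV4
import Literature.MathematicalPhysics.QuantumFieldTheory.Balaban1983to89.B9SectBL2GStepAtLettersV2

/-!
# `Balaban1983to89.B9SectBStepFrameV5` — THE LETTERS-LEVEL SECT.-B STEP FRAME, VERSION 5: `SectBFrame₅` + ★★ `sectBStepPrinted_of_sectBFrame₅`;
# = `SectBFrame₄` (p512949) with the SIX (3.46) member-steps of G(U′U) (Theorem 3.3's bond-sector operator) no longer DISPLAYED but FRAMED
# KERNEL-FREE by the ℓ²-block route (`B9SectBL2GStepAtLettersV2.L2GFrame₂` ∕ `stepL2Pos_of_l2GFrame₂`, on `B9Thm34GL2Entries.thm34_G_l2entries`);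
# ALL TWELVE `L²` member-steps of Sect. B are now theorems on the letters — displayed remain ONLY the three Hölder ∕ sup steps (3.43)–(3.45) of
# G(U′U) and, inside `L2GFrame₂`, ONE printed inequality ((3.77) for the concrete `P₁(A)` in block-ℓ²)

T. Bałaban, *Propagators for lattice gauge theories in a background field*, Commun. Math. Phys. **99** (1985) 389–434
[`Balaban1985BackgroundPropagators`, "B9"], Sect. B pp. 400–407 (Theorem 3.4); [4] = T. Bałaban, *Propagators and renormalization transformations
for lattice gauge theories. II*, Commun. Math. Phys. **96** (1984) 223–250 [`Balaban1984PropagatorsII`].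

statement-level skeleton of published theorems with citation tags; proofs where landed; nothing here is a claim about the Yang–Mills mass gap

WHY (pub-ymgap N06 row 13, seat dag-n06-c g6).  `B9SectBStepFrameV4.SectBFrame₄` framed the ten kernel-free Sect.-B steps and the six (3.46) members of
G′(U′U), and DISPLAYED nine G-side member-steps: the six (3.46) members of G(U′U) (`stepL2G`) and (3.43)–(3.45).  `B9SectBL2GStepAtLettersV2` (this seat,
g6) has since framed the six (3.46) members of G(U′U) on print's route p. 407 ((3.82)–(3.86) with (3.85) in block-ℓ², `B9Thm34GL2Entries`).
`SectBFrame₅` merges that dictionary (`L2GFrame₂`) in: `SectBFrame₅.stepL2G : StepL2Pos …  GA` is a THEOREM, `SectBFrame₅.toSectBFrame₄` shows v5 ⇒ v4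
(member projections `stepL2nPos_of_stepL2Pos`), and `sectBStepPrinted_of_sectBFrame₅` is the v4 capstone with the G-side `L²` block fed by the theorem.

WHAT IS IN THE FILE (0 sorry; standard axioms): `stepL2nPos_of_stepL2Pos` (whole (3.46) step ⇒ member steps); `structure SectBFrame₅ … extends GlobGFrame₂,
AnGFrame₂, GlobFrame₂, H1Frame₂, E4H2Frame₂, AnFrame₂, L2Frame₂, L2GFrame₂` (+ the member-2…5 readings ∕ writings of G′ as in v4; displayed `stepH1G stepE4G
stepH2G` ONLY); `SectBFrame₅.stepL2Gp`; `SectBFrame₅.stepL2G`; `SectBFrame₅.toSectBFrame₄`; ★★ `sectBStepPrinted_of_sectBFrame₅ (F) (Sg) (h32) (h33) :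
B9.SectBStepPrinted F.dB c35 geo bg Gp GA Cinv IsAnalyticExt`.

HONEST SCOPE.  Hypothesis structure; NOT shown inhabited; the three displayed Hölder ∕ sup steps of G(U′U) and the (3.77) field of `L2GFrame₂` are print's
statements (Theorem 3.3 × Theorem 3.4, p. 407; (3.77) p. 406), not proofs; count-neutral; NOT a node discharge; nothing continuum ∕ OS ∕ mass-gap ∕ Clay.
Cell `pub-ymgap` (HUMAN RULING D-0062), Track A node N06 [B9], N06-ASSIGNMENT row 13, seat `pub-ymgap-dag-n06-c` (g6), 2026-08-27.
-/

noncomputable section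

namespace Literature.MathematicalPhysics.QuantumFieldTheory.Balaban1983to89.B9SectBStepFrameV5

open Literature.MathematicalPhysics.QuantumFieldTheory.Balaban1983to89
open Literature.MathematicalPhysics.QuantumFieldTheory.Balaban1983to89.B6RandomWalkL2 (HasL2Majorant)
open Literature.MathematicalPhysics.QuantumFieldTheory.Balaban1983to89.B9Thm34Ext (toB6)
open Literature.MathematicalPhysics.QuantumFieldTheory.Balaban1983to89.B9Eq352DivFormLetters (conj)
open Literature.MathematicalPhysics.QuantumFieldTheory.Balaban1983to89.B9Eq352GradLetters (diffLetter)
open Literature.MathematicalPhysics.QuantumFieldTheory.Balaban1983to89.B9FromB6 (L2Block)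
open Literature.MathematicalPhysics.QuantumFieldTheory.Balaban1983to89.B9SectBStepWhole (StepPos StepL2Pos StepL2nPos StepH1Pos StepE4Pos StepH2Pos
  sectBStepPrinted_of_posBlockSteps stepL2Pos_of_members stepAnalyticPos_of_halves)
open Literature.MathematicalPhysics.QuantumFieldTheory.Balaban1983to89.B9SectBGpStepAtLettersV2 (GpFrame₂ CinvFrame₂ GlobFrame₂
  H1Frame₂ E4H2Frame₂ AnFrame₂ stepEPos_of_gpFrame₂ stepKerPos_of_cinvFrame₂ stepGlobPos_of_globFrame₂ stepH1Pos_of_h1Frame₂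
  stepE4Pos_of_e4h2Frame₂ stepH2Pos_of_e4h2Frame₂ stepAnalyticPos1_of_anFrame₂)
open Literature.MathematicalPhysics.QuantumFieldTheory.Balaban1983to89.B9SectBGStepAtLettersV2 (GFrame₂ GlobGFrame₂ AnGFrame₂
  stepEPos_of_gFrame₂ stepGlobPos_of_globGFrame₂ stepAnalyticPos1_of_anGFrame₂)
open Literature.MathematicalPhysics.QuantumFieldTheory.Balaban1983to89.B9SectBL2StepAtLettersV2 (L2Frame₂ stepL2nPos_zero_of_l2Frame₂
  stepL2nPos_one_of_l2Frame₂)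
open Literature.MathematicalPhysics.QuantumFieldTheory.Balaban1983to89.B9SectBL2StepAtLettersV2Right (stepL2nPos_two_of_l2Frame₂)
open Literature.MathematicalPhysics.QuantumFieldTheory.Balaban1983to89.B9SectBL2StepAtLettersV2Mixed (stepL2nPos_four_of_l2Frame₂)
open Literature.MathematicalPhysics.QuantumFieldTheory.Balaban1983to89.B9SectBL2StepAtLettersV2Second (stepL2nPos_three_of_l2Frame₂
  stepL2nPos_five_of_l2Frame₂)
open Literature.MathematicalPhysics.QuantumFieldTheory.Balaban1983to89.B9SectBStepFrameV4 (SectBFrame₄ sectBStepPrinted_of_sectBFrame₄)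
open Literature.MathematicalPhysics.QuantumFieldTheory.Balaban1983to89.B9SectBL2GStepAtLettersV2 (L2GFrame₂ stepL2Pos_of_l2GFrame₂)

universe u

/-! ## §0  The whole positive-input (3.46)-step yields every member-step -/

section Members

variable {I : Type} {d : ℕ} {c35 : ℝ} {geo : I → B9.Geometry} {bg : I → B9.Backgrounds}
  {Gp GA : ∀ i, B9.KernelFamily (geo i) (bg i)} {Cinv : ∀ i, B9.SiteKernel (geo i) (bg i)}

/-- The whole positive-input `L²` block-step (3.46) for K(U′U) gives each of its six member-steps (same thresholds and constants; the member is a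
conjunct of the block). [cite: Balaban1985BackgroundPropagators, Thm 3.1 (3.46) p.398 + Thm 3.4 p.400] -/
theorem stepL2nPos_of_stepL2Pos {K : ∀ i, B9.KernelFamily (geo i) (bg i)} (h : StepL2Pos d c35 geo bg Gp GA Cinv K) (n : Fin 6) :
    StepL2nPos d c35 geo bg Gp GA Cinv K n := by
  intro B₀ δ₀ Bβ Bε Bεβ B₁ δ₁ hB₀ hδ₀ hB₁ hδ₁
  obtain ⟨M₀, a₁, a₀', c, hM₀, ha₁, ha₀', hc, H⟩ := h B₀ δ₀ Bβ Bε Bεβ B₁ δ₁ hB₀ hδ₀ hB₁ hδ₁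
  refine ⟨M₀, a₁, a₀', c, hM₀, ha₁, ha₀', hc, ?_⟩
  intro i hM α₀ hα₀ hMa U hU hT α₁ hα₁ ha U' hU' lam hh y y' hcut hs
  exact H i hM α₀ hα₀ hMa U hU hT α₁ hα₁ ha U' hU' n lam hh y y' hcut hs

end Members

variable {I : Type} (c35 : ℝ) (geo : I → B9.Geometry) (bg : I → B9.Backgrounds)
  (Gp : ∀ i, B9.KernelFamily (geo i) (bg i))
  {𝔸 : Type u} [NormedRing 𝔸] [NormedAlgebra ℂ 𝔸] [CompleteSpace 𝔸] {ι : Type} [Fintype ι] [DecidableEq ι]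
  (b : Module.Basis ι ℝ 𝔸) (κ : Type) [Fintype κ] [LinearOrder κ]
  (S : I → Type) [∀ i, Fintype (S i)] [∀ i, DecidableEq (S i)]
  [∀ i, Fintype (geo i).Site] [∀ i, DecidableEq (geo i).Site] [∀ i, Nonempty (geo i).Site]

/-- **THE WHOLE SECT.-B LETTERS DICTIONARY, V5** — `SectBFrame₄`'s ten kernel-free steps and six G′ `L²` member-steps (via `L2Frame₂` + the member-2…5
readings ∕ writings) PLUS the `L²` letters dictionary `L2GFrame₂` of the bond-sector operator (the six (3.46) members of G(U′U), kernel-free on print's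
route p. 407, with its one displayed printed inequality (3.77)), with ONLY the THREE Hölder ∕ sup block-steps (3.43) ∕ (3.44) ∕ (3.45) of G(U′U) still
DISPLAYED verbatim.  A hypothesis structure; nothing asserted.
[cite: Balaban1985BackgroundPropagators, Thm 3.4 p.400 + Sect. B pp.400–407 + Thm 3.1 (3.43)–(3.46) p.398 + Thm 3.3 p.399 + p.403 l.1–9 + p.407] -/
structure SectBFrame₅ (GA : ∀ i, B9.KernelFamily (geo i) (bg i)) (Cinv : ∀ i, B9.SiteKernel (geo i) (bg i))
    (IsAnalyticExt : ∀ i, B9.KernelFamily (geo i) (bg i) → (bg i).Cfg → ℝ → Prop)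
    extends GlobGFrame₂ c35 geo bg Gp b κ S GA Cinv, AnGFrame₂ c35 geo bg Gp b κ S GA Cinv IsAnalyticExt,
      GlobFrame₂ c35 geo bg Gp b κ S, H1Frame₂ c35 geo bg Gp b κ S, E4H2Frame₂ c35 geo bg Gp b κ S,
      AnFrame₂ c35 geo bg Gp b κ S IsAnalyticExt, L2Frame₂ c35 geo bg Gp b κ S, L2GFrame₂ c35 geo bg Gp b κ S GA Cinv where
  /-- READING (3.46)₂ at U per concrete difference letter (reading constant `cL`). -/
  readL2_2 : ∀ i (α₀ : ℝ) (U : (bg i).Cfg) (B₀ δ : ℝ), MInv ≤ (geo i).M → 0 < α₀ → (geo i).M * α₀ ≤ aInv →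
    (bg i).Reg335 c35 α₀ U → 0 < B₀ → 0 < δ → L2Block (Gp i) B₀ δ U →
    ∀ k : κ ⊕ κ, HasL2Majorant (g := toB6 (geo i) (Rr i) (Hp i)) (fun p : S i × ι => blk i p.1)
      (Gop i U * conj b (diffLetter (T i) (coord i U) ((((geo i).eta : ℂ))⁻¹) k))
      (fun a a' => cL * B₀ * (geo i).len a * Real.exp (-(δ * (geo i).dist a a')))
  /-- WRITING (3.46)₂ at U′U from block-ℓ² majorants of every `G′(U′U)∇♯_k` (letters at the real U). -/
  writeL2_2 : ∀ i (U U' : (bg i).Cfg) (α₁ B δ : ℝ), 0 < α₁ → α₁ ≤ aW → (bg i).Cplx337 α₁ U U' → 0 ≤ B → 0 < δ →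
    (∀ k : κ ⊕ κ, HasL2Majorant (g := toB6 (geo i) (Rr i) (Hp i)) (fun p : S i × ι => blk i p.1)
        (Gop i ((bg i).mul U' U) * conj b (diffLetter (T i) (coord i U) ((((geo i).eta : ℂ))⁻¹) k))
        (fun a a' => B * (geo i).len a * Real.exp (-(δ * (geo i).dist a a')))) →
    ∀ (lam : (geo i).Loc) (h : (geo i).Cut) (y y' : (geo i).Site), (geo i).cutIn h y → (geo i).suppIn lam y' →
      (Gp i).l2 2 ((bg i).mul U' U) lam h ≤
        wL B δ * B9.pref6 ((geo i).len y) 2 * (geo i).cutSup h * Real.exp (-(wLδ δ * (geo i).dist y y')) * (geo i).l2Norm lam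
  /-- READING (3.46)₃ at U per PAIR of concrete difference letters: `∇_k∇_lG′(U) ≺₂ cL·B₀·1·e^{−δd}`. -/
  readL2_3 : ∀ i (α₀ : ℝ) (U : (bg i).Cfg) (B₀ δ : ℝ), MInv ≤ (geo i).M → 0 < α₀ → (geo i).M * α₀ ≤ aInv →
    (bg i).Reg335 c35 α₀ U → 0 < B₀ → 0 < δ → L2Block (Gp i) B₀ δ U →
    ∀ k l : κ ⊕ κ, HasL2Majorant (g := toB6 (geo i) (Rr i) (Hp i)) (fun p : S i × ι => blk i p.1)
      (conj b (diffLetter (T i) (coord i U) ((((geo i).eta : ℂ))⁻¹) k) *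
        conj b (diffLetter (T i) (coord i U) ((((geo i).eta : ℂ))⁻¹) l) * Gop i U)
      (fun a a' => cL * B₀ * 1 * Real.exp (-(δ * (geo i).dist a a')))
  /-- WRITING (3.46)₃ at U′U from block-ℓ² majorants of every `∇_k∇_lG′(U′U)` (letters at the real U). -/
  writeL2_3 : ∀ i (U U' : (bg i).Cfg) (α₁ B δ : ℝ), 0 < α₁ → α₁ ≤ aW → (bg i).Cplx337 α₁ U U' → 0 ≤ B → 0 < δ →
    (∀ k l : κ ⊕ κ, HasL2Majorant (g := toB6 (geo i) (Rr i) (Hp i)) (fun p : S i × ι => blk i p.1)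
        (conj b (diffLetter (T i) (coord i U) ((((geo i).eta : ℂ))⁻¹) k) *
          conj b (diffLetter (T i) (coord i U) ((((geo i).eta : ℂ))⁻¹) l) * Gop i ((bg i).mul U' U))
        (fun a a' => B * 1 * Real.exp (-(δ * (geo i).dist a a')))) →
    ∀ (lam : (geo i).Loc) (h : (geo i).Cut) (y y' : (geo i).Site), (geo i).cutIn h y → (geo i).suppIn lam y' →
      (Gp i).l2 3 ((bg i).mul U' U) lam h ≤
        wL B δ * B9.pref6 ((geo i).len y) 3 * (geo i).cutSup h * Real.exp (-(wLδ δ * (geo i).dist y y')) * (geo i).l2Norm lam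
  /-- READING of the mixed member (3.46)₄ at U per pair of concrete difference letters. -/
  readL2_4 : ∀ i (α₀ : ℝ) (U : (bg i).Cfg) (B₀ δ : ℝ), MInv ≤ (geo i).M → 0 < α₀ → (geo i).M * α₀ ≤ aInv →
    (bg i).Reg335 c35 α₀ U → 0 < B₀ → 0 < δ → L2Block (Gp i) B₀ δ U →
    ∀ k l : κ ⊕ κ, HasL2Majorant (g := toB6 (geo i) (Rr i) (Hp i)) (fun p : S i × ι => blk i p.1)
      (conj b (diffLetter (T i) (coord i U) ((((geo i).eta : ℂ))⁻¹) k) * Gop i U *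
        conj b (diffLetter (T i) (coord i U) ((((geo i).eta : ℂ))⁻¹) l))
      (fun a a' => cL * B₀ * 1 * Real.exp (-(δ * (geo i).dist a a')))
  /-- WRITING of the mixed member (3.46)₄ at U′U from block-ℓ² majorants of every `∇_kG′(U′U)∇♯_l`. -/
  writeL2_4 : ∀ i (U U' : (bg i).Cfg) (α₁ B δ : ℝ), 0 < α₁ → α₁ ≤ aW → (bg i).Cplx337 α₁ U U' → 0 ≤ B → 0 < δ →
    (∀ k l : κ ⊕ κ, HasL2Majorant (g := toB6 (geo i) (Rr i) (Hp i)) (fun p : S i × ι => blk i p.1)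
        (conj b (diffLetter (T i) (coord i U) ((((geo i).eta : ℂ))⁻¹) k) * Gop i ((bg i).mul U' U) *
          conj b (diffLetter (T i) (coord i U) ((((geo i).eta : ℂ))⁻¹) l))
        (fun a a' => B * 1 * Real.exp (-(δ * (geo i).dist a a')))) →
    ∀ (lam : (geo i).Loc) (h : (geo i).Cut) (y y' : (geo i).Site), (geo i).cutIn h y → (geo i).suppIn lam y' →
      (Gp i).l2 4 ((bg i).mul U' U) lam h ≤
        wL B δ * B9.pref6 ((geo i).len y) 4 * (geo i).cutSup h * Real.exp (-(wLδ δ * (geo i).dist y y')) * (geo i).l2Norm lam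
  /-- READING (3.46)₅ at U per PAIR of concrete difference letters: `G′(U)∇♯_k∇♯_l ≺₂ cL·B₀·1·e^{−δd}`. -/
  readL2_5 : ∀ i (α₀ : ℝ) (U : (bg i).Cfg) (B₀ δ : ℝ), MInv ≤ (geo i).M → 0 < α₀ → (geo i).M * α₀ ≤ aInv →
    (bg i).Reg335 c35 α₀ U → 0 < B₀ → 0 < δ → L2Block (Gp i) B₀ δ U →
    ∀ k l : κ ⊕ κ, HasL2Majorant (g := toB6 (geo i) (Rr i) (Hp i)) (fun p : S i × ι => blk i p.1)
      (Gop i U * conj b (diffLetter (T i) (coord i U) ((((geo i).eta : ℂ))⁻¹) k) *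
        conj b (diffLetter (T i) (coord i U) ((((geo i).eta : ℂ))⁻¹) l))
      (fun a a' => cL * B₀ * 1 * Real.exp (-(δ * (geo i).dist a a')))
  /-- WRITING (3.46)₅ at U′U from block-ℓ² majorants of every `G′(U′U)∇♯_k∇♯_l` (letters at the real U). -/
  writeL2_5 : ∀ i (U U' : (bg i).Cfg) (α₁ B δ : ℝ), 0 < α₁ → α₁ ≤ aW → (bg i).Cplx337 α₁ U U' → 0 ≤ B → 0 < δ →
    (∀ k l : κ ⊕ κ, HasL2Majorant (g := toB6 (geo i) (Rr i) (Hp i)) (fun p : S i × ι => blk i p.1)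
        (Gop i ((bg i).mul U' U) * conj b (diffLetter (T i) (coord i U) ((((geo i).eta : ℂ))⁻¹) k) *
          conj b (diffLetter (T i) (coord i U) ((((geo i).eta : ℂ))⁻¹) l))
        (fun a a' => B * 1 * Real.exp (-(δ * (geo i).dist a a')))) →
    ∀ (lam : (geo i).Loc) (h : (geo i).Cut) (y y' : (geo i).Site), (geo i).cutIn h y → (geo i).suppIn lam y' →
      (Gp i).l2 5 ((bg i).mul U' U) lam h ≤
        wL B δ * B9.pref6 ((geo i).len y) 5 * (geo i).cutSup h * Real.exp (-(wLδ δ * (geo i).dist y y')) * (geo i).l2Norm lam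
  /-- DISPLAYED (3.43) for G(U′U) (p. 407). -/
  stepH1G : StepH1Pos dB c35 geo bg Gp GA Cinv GA
  /-- DISPLAYED (3.44) for G(U′U) (p. 407). -/
  stepE4G : StepE4Pos dB c35 geo bg Gp GA Cinv GA
  /-- DISPLAYED (3.45) for G(U′U) (p. 407). -/
  stepH2G : StepH2Pos dB c35 geo bg Gp GA Cinv GA

variable {c35 geo bg Gp b κ S}

/-- **All six (3.46) member-steps of G′(U′U) from a `SectBFrame₅` are theorems on the letters** (as `SectBFrame₄.stepL2Gp`).
[cite: Balaban1985BackgroundPropagators, Thm 3.1 (3.46) p.398 + Thm 3.4 p.400 + p.403 l.1–9] -/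
theorem SectBFrame₅.stepL2Gp {GA : ∀ i, B9.KernelFamily (geo i) (bg i)} {Cinv : ∀ i, B9.SiteKernel (geo i) (bg i)}
    {IsAnalyticExt : ∀ i, B9.KernelFamily (geo i) (bg i) → (bg i).Cfg → ℝ → Prop}
    (F : SectBFrame₅ c35 geo bg Gp b κ S GA Cinv IsAnalyticExt) : ∀ n : Fin 6, StepL2nPos F.dB c35 geo bg Gp GA Cinv Gp n := by
  intro n
  fin_cases n
  · exact stepL2nPos_zero_of_l2Frame₂ F.toL2Frame₂ GA Cinv
  · exact stepL2nPos_one_of_l2Frame₂ F.toL2Frame₂ GA Cinv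
  · exact stepL2nPos_two_of_l2Frame₂ F.toL2Frame₂ F.readL2_2 F.writeL2_2 GA Cinv
  · exact stepL2nPos_three_of_l2Frame₂ F.toL2Frame₂ F.readL2_3 F.writeL2_3 GA Cinv
  · exact stepL2nPos_four_of_l2Frame₂ F.toL2Frame₂ F.readL2_2 F.readL2_4 F.writeL2_4 GA Cinv
  · exact stepL2nPos_five_of_l2Frame₂ F.toL2Frame₂ F.readL2_2 F.readL2_5 F.writeL2_5 GA Cinv

/-- ★ **The whole (3.46)-step of G(U′U) from a `SectBFrame₅` is a THEOREM on the letters** (`B9SectBL2GStepAtLettersV2.stepL2Pos_of_l2GFrame₂`: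
the ℓ²-block route p. 407, kernel-free). [cite: Balaban1985BackgroundPropagators, Thm 3.3 p.399 + Thm 3.4 p.400 + (3.82)–(3.86) p.407] -/
theorem SectBFrame₅.stepL2G {GA : ∀ i, B9.KernelFamily (geo i) (bg i)} {Cinv : ∀ i, B9.SiteKernel (geo i) (bg i)}
    {IsAnalyticExt : ∀ i, B9.KernelFamily (geo i) (bg i) → (bg i).Cfg → ℝ → Prop}
    (F : SectBFrame₅ c35 geo bg Gp b κ S GA Cinv IsAnalyticExt) : StepL2Pos F.dB c35 geo bg Gp GA Cinv GA :=
  stepL2Pos_of_l2GFrame₂ F.toL2GFrame₂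

/-- **v5 ⇒ v4**: a `SectBFrame₅` yields a `SectBFrame₄` whose six displayed G-side `L²` member-steps are filled by the member projections of the
theorem `SectBFrame₅.stepL2G`. [cite: Balaban1985BackgroundPropagators, Thm 3.3 p.399 + Thm 3.4 p.400 + p.407] -/
def SectBFrame₅.toSectBFrame₄ {GA : ∀ i, B9.KernelFamily (geo i) (bg i)} {Cinv : ∀ i, B9.SiteKernel (geo i) (bg i)}
    {IsAnalyticExt : ∀ i, B9.KernelFamily (geo i) (bg i) → (bg i).Cfg → ℝ → Prop}
    (F : SectBFrame₅ c35 geo bg Gp b κ S GA Cinv IsAnalyticExt) : SectBFrame₄ c35 geo bg Gp b κ S GA Cinv IsAnalyticExt :=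
  { F with stepL2G := fun n => stepL2nPos_of_stepL2Pos F.stepL2G n }

/-- ★★ **ROW 13's `hB` IN ONE INSTANTIATION (v5)**: every `SectBFrame₅`, with the model signs of the readings and Theorems 3.2 ∕ 3.3 of the leaf, yields
`B9.SectBStepPrinted F.dB c35 geo bg Gp GA Cinv IsAnalyticExt` — as `B9SectBStepFrameV4.sectBStepPrinted_of_sectBFrame₄`, with the (3.46) block of
G(U′U) now the theorem `SectBFrame₅.stepL2G` (ALL TWELVE `L²` member-steps of Sect. B are theorems on the letters).  Honest scope: the frame is NOT shown
inhabited; nothing of Sect. B is asserted beyond what the tree's theorems prove; the three displayed Hölder ∕ sup steps of G(U′U) and the (3.77) field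
are print's statements, not proofs.
[cite: Balaban1985BackgroundPropagators, Thm 3.4 p.400 + Sect. B pp.400–407 + Thms 3.1–3.3 pp.397–399] -/
theorem sectBStepPrinted_of_sectBFrame₅ {GA : ∀ i, B9.KernelFamily (geo i) (bg i)} {Cinv : ∀ i, B9.SiteKernel (geo i) (bg i)}
    {IsAnalyticExt : ∀ i, B9.KernelFamily (geo i) (bg i) → (bg i).Cfg → ℝ → Prop}
    (F : SectBFrame₅ c35 geo bg Gp b κ S GA Cinv IsAnalyticExt)
    {P : ∀ i, (geo i).Loc → Prop} (Sg : ∀ i, B9FromB6ModelSignsOn.ModelSignsOn (geo i) (P i))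
    (h32 : B9.Thm32Printed F.dB c35 geo bg Cinv) (h33 : B9.Thm33Printed c35 geo bg Gp GA) :
    B9.SectBStepPrinted F.dB c35 geo bg Gp GA Cinv IsAnalyticExt :=
  sectBStepPrinted_of_posBlockSteps Sg h32 h33
    (stepAnalyticPos_of_halves
      (stepAnalyticPos1_of_anFrame₂ F.toAnFrame₂ GA Cinv)
      (stepAnalyticPos1_of_anGFrame₂ F.toAnGFrame₂ F.d261 F.h261))
    (stepEPos_of_gpFrame₂ F.toGpFrame₂ GA Cinv)
    (stepL2Pos_of_members Sg F.stepL2Gp)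
    (stepGlobPos_of_globFrame₂ F.toGlobFrame₂ GA Cinv)
    (stepH1Pos_of_h1Frame₂ F.toH1Frame₂ GA Cinv)
    (stepE4Pos_of_e4h2Frame₂ F.toE4H2Frame₂ GA Cinv)
    (stepH2Pos_of_e4h2Frame₂ F.toE4H2Frame₂ GA Cinv)
    (stepKerPos_of_cinvFrame₂ F.toCinvFrame₂ GA)
    (stepEPos_of_gFrame₂ F.toGFrame₂ F.d261 F.h261)
    F.stepL2G
    (stepGlobPos_of_globGFrame₂ F.toGlobGFrame₂ F.d261 F.h261) F.stepH1G F.stepE4G F.stepH2G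

end Literature.MathematicalPhysics.QuantumFieldTheory.Balaban1983to89.B9SectBStepFrameV5
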